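import Mathlib
import Summits.CriticalPhenomena.SAWScalingLimit.Theorems.SAWDefectDecoherenceDefectDecoherenceSsDressingPairs
import Summits.CriticalPhenomena.SAWScalingLimit.Theorems.SAWDefectDecoherenceDefectDecoherenceSsStarMassHarnack
import HarnessLib

/-!
# The size of the dressing from the return-loop bound
(helpers `ss_dirtyMass_le_cleanMass_of_loopBound`, `ss_cleanMass_le_mass`,
`ss_dirtyMass_le_of_loopBound`, `ss_norm_dressedDefect_le_of_loopBound` for the stub
`stub_dressedDefectDecay` of the line `sector-slaving`, crux `DefectDecoherence`,
stmt-CriticalPhenomena-8549)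

Fix a simply connected `Λ`, an adjacent boundary root `a = s(u,w)` (`u ∉ Λ ∋ w`) and a `1`-deep
vertex `v` (so `v` and its three neighbours lie in `Λ`, and `w ≠ v`).  For a dart `y → v`
(`y ∈ star Λ v`) write
* `A_y = Σ_{ω : a → s(y,v), last vertex y, v ∉ ω} x_c^{ℓ(ω)+1}` — the CLEAN arrivals at `v` through
  `y → v` (`Σ_y A_y` is the clean arrival mass `A_0(v)`, the majorant of every `‖A_ξ(v)‖`);
* `R_y = Σ_{γ : a → s(y,v), last vertex y, v ∈ γ} x_c^{ℓ(γ)}` — the RETURN LOOPS at `(v,y)`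
  (the dirty arrivals; `x_c Σ_y R_y = Ā_0(v) - A_0(v)` is the dirty mass of `…SsDressingPairs`);
* `Z_y = Σ_{γ : a → s(y,v)} x_c^{ℓ(γ)}` (`Σ_y Z_y = M(v)`, `har_mass_eq_sum_in`).

Under a bound `N` on the `x_c`-mass of the walks of every simply connected domain between two
boundary mid-edges at a common exterior vertex (the tip return-loop bound, a HYPOTHESIS here):
`R_y ≤ N · Σ_{q ≠ y} V(q;y)` (`har_returnLoop_le` at the tip `t := v`), where `V(q;y)`, the mass of
the via-`v` walks at the dart `(v,q)` avoiding `y`, is at most `A` of the third dart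
(`har_viaT_avoiding_le_clean`); summing over the six ordered pairs of darts,
`Σ_y R_y ≤ 2N Σ_y A_y`, i.e. **dirty mass `≤ 2 x_c N ·` clean arrival mass**
(`ss_dirtyMass_le_cleanMass_of_loopBound`).  Unconditionally `A_y ≤ x_c Z_y`
(`har_clean_le_viaY`), so clean arrival mass `≤ x_c M(v)` (`ss_cleanMass_le_mass`), dirty mass
`≤ 2 x_c² N M(v)` (`ss_dirtyMass_le_of_loopBound`) and, by the pairing bound
`‖Ā_D - A_D‖ ≤ (√3/2)·(dirty mass)` (`ss_norm_dressedDefect_le`),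
**`‖dressedDefect(v)‖ ≤ √3 x_c² N M(v)`** (`ss_norm_dressedDefect_le_of_loopBound`).

This is a SIZE bound only (`θ = 0`, constant `∝ N`): the rigorous form of "the loop-dressed
sub-population is an `N`-fraction of the mass".  The DECAY `DecayBound dressedDefect C θ`,
`θ > 3/4` (stub `stub_dressedDefectDecay`) is a decoherence statement for the loop-mass-reweighted
clean `D`-character and is the open content of the stub — nothing in this file supplies it.

Sources: H. Duminil-Copin, S. Smirnov, Ann. of Math. 175 (2012) (arXiv:1007.0575), §1–§2 (walks
between mid-edges, proof of Lemma 1); the line card `Lines/sector-slaving.md`.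
-/

noncomputable section

open scoped BigOperators ComplexConjugate Classical
open Literature.Probability.LatticeModels Literature.Probability.RandomPlanarGeometry.SAW
open Summit.CriticalPhenomena.SAWScalingLimit.Theorems.DefectDecoherence.TipMartingale

namespace Summit.CriticalPhenomena.SAWScalingLimit.Theorems.DefectDecoherence.SectorSlaving

/-! ### Geometry of a `1`-deep vertex -/

section DeepOne

variable {Λ : Finset HexVertex} {u w v : HexVertex}

/-- A `1`-deep vertex lies in `Λ`. [folklore] -/
private theorem dlb_mem (hdeep : Deep Λ v 1) : v ∈ Λ :=
  hdeep v (by rw [dist_self]; exact zero_le_one)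

/-- The neighbours of a `1`-deep vertex lie in `Λ` (adjacent centres are at distance
`1/√3 ≤ 1`). [folklore] -/
private theorem dlb_nbrs_mem (hdeep : Deep Λ v 1) : ∀ y, hexGraph.Adj v y → y ∈ Λ :=
  fun y hy => hdeep y (dist_hexCenter_le_one_of_adj hy.symm)

/-- At a `1`-deep vertex `v` (root `s(u,w)`, `u ∉ Λ`, `u ∼ w`) the root vertex `w` is not `v`
(else `u ∼ v` would lie in `Λ`). [folklore] -/
private theorem dlb_root_ne (hdeep : Deep Λ v 1) (huw : hexGraph.Adj u w) (hu : u ∉ Λ) :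
    w ≠ v := by
  rintro rfl
  exact hu (hdeep u (dist_hexCenter_le_one_of_adj huw))

end DeepOne

/-! ### The dirty mass against the clean arrival mass -/

/-- **Registered helper `ss_dirtyMass_le_cleanMass_of_loopBound`: the dirty mass is an
`N`-fraction of the clean arrival mass.**  Under a bound `N ≥ 0` on the `x_c`-mass of the walks
of every simply connected domain between two boundary mid-edges at a common exterior vertex, at a
`1`-deep vertex `v` of a simply connected `Λ` with adjacent boundary root `s(u,w)` (`u ∉ Λ ∋ w`):
`Σ_{s ∼ v} Σ_{γ : a → s(s,v), last vertex s, v ∈ γ} x_c^{ℓ+1} ≤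
2 x_c N · Σ_{s ∼ v} Σ_{ω : a → s(s,v), last vertex s, v ∉ ω} x_c^{ℓ+1}`
(return loops re-summed over their prefix at the tip `v`; the prefix, a via-`v` walk avoiding the
return dart, is a clean arrival through the third dart prolonged by `v`).  SIZE bound only
(`θ = 0`, constant `∝ N`); the decay of the dressed defect is the open content of the stub
`stub_dressedDefectDecay`. [folklore] -/
theorem ss_dirtyMass_le_cleanMass_of_loopBound : ∀ N : ℝ, 0 ≤ N → (∀ (Λ' : Finset HexVertex),
    hexDomainSimplyConnected Λ' → ∀ (t q s : HexVertex), t ∉ Λ' → q ∈ Λ' → s ∈ Λ' →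
    hexGraph.Adj t q → hexGraph.Adj t s → q ≠ s →
    (∑ τ : HexMidEdgeSAW Λ' s(t, q) s(s, t), xc ^ τ.length) ≤ N) →
    ∀ (Λ : Finset HexVertex), hexDomainSimplyConnected Λ → ∀ (u w : HexVertex), hexGraph.Adj u w →
    u ∉ Λ → w ∈ Λ → ∀ v : HexVertex, Deep Λ v 1 →
    (∑ s ∈ star Λ v, ∑ γ : HexMidEdgeSAW Λ s(u, w) s(s, v),
        (if γ.verts.getLast? = some s ∧ v ∈ γ.verts then xc ^ (γ.length + 1) else 0 : ℝ)) ≤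
      2 * xc * N * ∑ s ∈ star Λ v, ∑ γ : HexMidEdgeSAW Λ s(u, w) s(s, v),
        (if γ.verts.getLast? = some s ∧ v ∉ γ.verts then xc ^ (γ.length + 1) else 0 : ℝ) := by
  intro N hN0 hN Λ hΛ u w huw hu _ v hdeep
  have hvΛ : v ∈ Λ := dlb_mem hdeep
  have hΛv : ∀ y, hexGraph.Adj v y → y ∈ Λ := dlb_nbrs_mem hdeep
  have hwv : w ≠ v := dlb_root_ne hdeep huw hu
  -- dirty arrivals through a dart, with `v` counted, are `x_c ·` the return loops at that dart
  have hDR : ∀ y : HexVertex, (∑ γ : HexMidEdgeSAW Λ s(u, w) s(y, v),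
      (if γ.verts.getLast? = some y ∧ v ∈ γ.verts then xc ^ (γ.length + 1) else 0 : ℝ)) =
      xc * ∑ γ : HexMidEdgeSAW Λ s(u, w) s(y, v),
        (if γ.verts.getLast? = some y ∧ v ∈ γ.verts then xc ^ γ.length else 0 : ℝ) := by
    intro y
    rw [Finset.mul_sum]
    refine Finset.sum_congr rfl fun γ _ => ?_
    split_ifs
    · rw [pow_succ, mul_comm]
    · rw [mul_zero]
  -- the three darts at `v`
  have hne : (hexGraph.neighborSet v).Nonempty :=
    Set.nonempty_of_ncard_ne_zero (by rw [card_neighborSet_hexGraph_holds v]; norm_num)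
  obtain ⟨s₀, hvs₀⟩ := hne
  rw [SimpleGraph.mem_neighborSet] at hvs₀
  obtain ⟨n₁, n₂, n₃⟩ := tip_rot3_ne hvs₀
  have hstar := tip_star_eq hvs₀ hΛv
  set s₁ := rot3 v s₀ with hs₁
  set s₂ := rot3 v (rot3 v s₀) with hs₂
  have h0 : s₀ ∈ star Λ v := by rw [hstar]; simp
  have h1 : s₁ ∈ star Λ v := by rw [hstar]; simp
  have h2 : s₂ ∈ star Λ v := by rw [hstar]; simp
  have hcov : ∀ y ∈ star Λ v, y = s₀ ∨ y = s₁ ∨ y = s₂ := fun y hy => by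
    simpa [hstar] using hy
  -- the quantities at the darts of `v`
  set A : HexVertex → ℝ := fun y => ∑ ω : HexMidEdgeSAW Λ s(u, w) s(y, v),
    (if ω.verts.getLast? = some y ∧ v ∉ ω.verts then xc ^ (ω.length + 1) else 0 : ℝ) with hA
  set R : HexVertex → ℝ := fun y => ∑ γ : HexMidEdgeSAW Λ s(u, w) s(y, v),
    (if γ.verts.getLast? = some y ∧ v ∈ γ.verts then xc ^ γ.length else 0 : ℝ) with hR
  set V : HexVertex → HexVertex → ℝ := fun q s => ∑ π : HexMidEdgeSAW Λ s(u, w) s(v, q),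
    (if π.verts.getLast? = some v ∧ s ∉ π.verts then xc ^ π.length else 0 : ℝ) with hV
  -- a via-`v` walk at the dart `(v,q)` avoiding `s` came through the third dart
  have e10 : V s₁ s₀ ≤ A s₂ := har_viaT_avoiding_le_clean hu hvΛ hwv h1 fun y hy => by
    rcases hcov y hy with h | h | h <;> simp [h]
  have e20 : V s₂ s₀ ≤ A s₁ := har_viaT_avoiding_le_clean hu hvΛ hwv h2 fun y hy => by
    rcases hcov y hy with h | h | h <;> simp [h]
  have e01 : V s₀ s₁ ≤ A s₂ := har_viaT_avoiding_le_clean hu hvΛ hwv h0 fun y hy => by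
    rcases hcov y hy with h | h | h <;> simp [h]
  have e21 : V s₂ s₁ ≤ A s₀ := har_viaT_avoiding_le_clean hu hvΛ hwv h2 fun y hy => by
    rcases hcov y hy with h | h | h <;> simp [h]
  have e02 : V s₀ s₂ ≤ A s₁ := har_viaT_avoiding_le_clean hu hvΛ hwv h0 fun y hy => by
    rcases hcov y hy with h | h | h <;> simp [h]
  have e12 : V s₁ s₂ ≤ A s₀ := har_viaT_avoiding_le_clean hu hvΛ hwv h1 fun y hy => by
    rcases hcov y hy with h | h | h <;> simp [h]
  -- the return loops under the loop bound, re-summed over their prefix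
  have hR0 : R s₀ ≤ N * ∑ q ∈ star Λ v, (if q = s₀ then 0 else V q s₀) :=
    har_returnLoop_le hΛ huw hu hvΛ hwv h0 hN0 hN
  have hR1 : R s₁ ≤ N * ∑ q ∈ star Λ v, (if q = s₁ then 0 else V q s₁) :=
    har_returnLoop_le hΛ huw hu hvΛ hwv h1 hN0 hN
  have hR2 : R s₂ ≤ N * ∑ q ∈ star Λ v, (if q = s₂ then 0 else V q s₂) :=
    har_returnLoop_le hΛ huw hu hvΛ hwv h2 hN0 hN
  rw [hstar, har_sum_three n₁ n₂ n₃, if_neg n₁.symm, if_neg n₂.symm, if_pos rfl, zero_add] at hR0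
  rw [hstar, har_sum_three n₁ n₂ n₃, if_neg n₁, if_neg n₃.symm, if_pos rfl, add_zero] at hR1
  rw [hstar, har_sum_three n₁ n₂ n₃, if_neg n₂, if_neg n₃, if_pos rfl, add_zero] at hR2
  have hsum : R s₀ + R s₁ + R s₂ ≤ 2 * N * (A s₀ + A s₁ + A s₂) := by
    have m0 : N * (V s₁ s₀ + V s₂ s₀) ≤ N * (A s₂ + A s₁) :=
      mul_le_mul_of_nonneg_left (add_le_add e10 e20) hN0
    have m1 : N * (V s₀ s₁ + V s₂ s₁) ≤ N * (A s₂ + A s₀) :=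
      mul_le_mul_of_nonneg_left (add_le_add e01 e21) hN0
    have m2 : N * (V s₀ s₂ + V s₁ s₂) ≤ N * (A s₁ + A s₀) :=
      mul_le_mul_of_nonneg_left (add_le_add e02 e12) hN0
    linarith
  -- assemble over the star
  have key := mul_le_mul_of_nonneg_left hsum xc_pos.le
  rw [hstar, har_sum_three n₁ n₂ n₃, har_sum_three n₁ n₂ n₃, hDR s₀, hDR s₁, hDR s₂]
  linarith

/-- **Registered helper `ss_cleanMass_le_mass`: the clean arrival mass is at most `x_c M(v)`**
(unconditional, every configuration): a clean arrival at `v` through the dart `s → v`, `v` counted,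
weighs `x_c` times a via-`s` walk at the mid-edge `{s,v}` (`har_clean_le_viaY`), and
`M(v) = Σ_{s ∼ v} Z(s(s,v))`. [folklore] -/
theorem ss_cleanMass_le_mass : ∀ (Λ : Finset HexVertex) (u w v : HexVertex),
    (∑ s ∈ star Λ v, ∑ γ : HexMidEdgeSAW Λ s(u, w) s(s, v),
        (if γ.verts.getLast? = some s ∧ v ∉ γ.verts then xc ^ (γ.length + 1) else 0 : ℝ)) ≤
      xc * mass Λ u w v := by
  intro Λ u w v
  rw [har_mass_eq_sum_in, Finset.mul_sum]
  refine Finset.sum_le_sum fun y _ => ?_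
  refine (har_clean_le_viaY y).trans (mul_le_mul_of_nonneg_left ?_ xc_pos.le)
  refine Finset.sum_le_sum fun γ _ => ?_
  split_ifs
  · exact le_rfl
  · exact pow_nonneg xc_pos.le _

/-! ### The dirty mass and the dressed defect against the star mass -/

/-- **Registered helper `ss_dirtyMass_le_of_loopBound`: the dirty mass is an `N`-fraction of the
star mass.**  Under the loop bound `N ≥ 0`, at a `1`-deep vertex `v` of a simply connected `Λ`
with adjacent boundary root `s(u,w)` (`u ∉ Λ ∋ w`):
`Σ_{s ∼ v} Σ_{γ : a → s(s,v), last vertex s, v ∈ γ} x_c^{ℓ+1} ≤ 2 x_c² N · M(v)`.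
SIZE bound only (`θ = 0`, constant `∝ N`); the decay is the open content of the stub
`stub_dressedDefectDecay`. [folklore] -/
theorem ss_dirtyMass_le_of_loopBound : ∀ N : ℝ, 0 ≤ N → (∀ (Λ' : Finset HexVertex),
    hexDomainSimplyConnected Λ' → ∀ (t q s : HexVertex), t ∉ Λ' → q ∈ Λ' → s ∈ Λ' →
    hexGraph.Adj t q → hexGraph.Adj t s → q ≠ s →
    (∑ τ : HexMidEdgeSAW Λ' s(t, q) s(s, t), xc ^ τ.length) ≤ N) →
    ∀ (Λ : Finset HexVertex), hexDomainSimplyConnected Λ → ∀ (u w : HexVertex), hexGraph.Adj u w →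
    u ∉ Λ → w ∈ Λ → ∀ v : HexVertex, Deep Λ v 1 →
    (∑ s ∈ star Λ v, ∑ γ : HexMidEdgeSAW Λ s(u, w) s(s, v),
        (if γ.verts.getLast? = some s ∧ v ∈ γ.verts then xc ^ (γ.length + 1) else 0 : ℝ)) ≤
      2 * xc ^ 2 * N * mass Λ u w v := by
  intro N hN0 hN Λ hΛ u w huw hu hw v hdeep
  have h1 := ss_dirtyMass_le_cleanMass_of_loopBound N hN0 hN Λ hΛ u w huw hu hw v hdeep
  have h2 := ss_cleanMass_le_mass Λ u w v
  have h3 : 0 ≤ 2 * xc * N := mul_nonneg (mul_nonneg zero_le_two xc_pos.le) hN0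
  calc _ ≤ _ := h1
    _ ≤ 2 * xc * N * (xc * mass Λ u w v) := mul_le_mul_of_nonneg_left h2 h3
    _ = 2 * xc ^ 2 * N * mass Λ u w v := by ring

/-- **Registered helper `ss_norm_dressedDefect_le_of_loopBound`: a-priori SIZE of the dressing
from the return-loop bound.**  Under a bound `N ≥ 0` on the `x_c`-mass of the walks of every
simply connected domain between two boundary mid-edges at a common exterior vertex (the tip
return-loop bound), at a `1`-deep vertex `v` of a simply connected `Λ` with adjacent boundary root
`s(u,w)` (`u ∉ Λ ∋ w`): `‖Ā_D(v) - A_D(v)‖ ≤ √3 x_c² N · M(v)` (`K = √3 x_c²`: the pairing factor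
`√3/2`, twice `x_c N ·` clean arrival mass for the dirty mass, `x_c M` for the clean arrival
mass).  SIZE bound only (`θ = 0`, constant `∝ N`): the DECAY `DecayBound dressedDefect C θ` with
`θ > 3/4` is the open content of the stub `stub_dressedDefectDecay` and is NOT supplied here.
[folklore] -/
theorem ss_norm_dressedDefect_le_of_loopBound : ∀ N : ℝ, 0 ≤ N → (∀ (Λ' : Finset HexVertex),
    hexDomainSimplyConnected Λ' → ∀ (t q s : HexVertex), t ∉ Λ' → q ∈ Λ' → s ∈ Λ' →
    hexGraph.Adj t q → hexGraph.Adj t s → q ≠ s →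
    (∑ τ : HexMidEdgeSAW Λ' s(t, q) s(s, t), xc ^ τ.length) ≤ N) →
    ∀ (Λ : Finset HexVertex), hexDomainSimplyConnected Λ → ∀ (u w : HexVertex), hexGraph.Adj u w →
    u ∉ Λ → w ∈ Λ → ∀ v : HexVertex, Deep Λ v 1 →
    ‖dressedDefect Λ u w v‖ ≤ Real.sqrt 3 * xc ^ 2 * N * mass Λ u w v := by
  intro N hN0 hN Λ hΛ u w huw hu hw v hdeep
  have h1 := ss_norm_dressedDefect_le Λ hΛ u w huw hu hw v hdeep
  have h2 := ss_dirtyMass_le_of_loopBound N hN0 hN Λ hΛ u w huw hu hw v hdeep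
  calc ‖dressedDefect Λ u w v‖ ≤ _ := h1
    _ ≤ Real.sqrt 3 / 2 * (2 * xc ^ 2 * N * mass Λ u w v) :=
        mul_le_mul_of_nonneg_left h2 (by positivity)
    _ = Real.sqrt 3 * xc ^ 2 * N * mass Λ u w v := by ring

end Summit.CriticalPhenomena.SAWScalingLimit.Theorems.DefectDecoherence.SectorSlaving

end
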